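import Summits.ValiantsHypothesis.ValiantsHypothesis.Theorems.BarrierLeverAnchoredDoorHitsLowerPairsTotalMultiPeel
import Summits.ValiantsHypothesis.ValiantsHypothesis.Theorems.BarrierLeverAnchoredDoorHitsLowerPairsBalancedMatching

/-!
# Support item `AnchoredDoorHitsLowerPairs` (stmt-ValiantsHypothesis-22510), line `anchored-peeling`:
# CONJECTURE L ⟹ the cube against EVERY complex on `n + 1` vertices is hit (kernel reduction of branch (i) of the UQ residual)

Helper file (`--supports stmt-ValiantsHypothesis-22510`; cell valiant-natproofs, rung V4, 𝒟-side door (c); registered line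
`Cruxes/AnchoredDoorHitsLowerPairs/Lines/anchored_peeling.lean` v14 — after `stub_uqFaceStep` (p626525) the open content of the composition
`AnchoredDoorHitsLowerPairs_of` is the residual `Stmt.stub_uqFaceResidual`; its branch (i) (memo HOME/val-np-p1/g19/PEEL-HALL-valnp1-g19.md §19–§20)
is «cube `2^X` versus a lower family of `2^{|X|}` faces on `|X| + 1` vertices». Prover seat val-np-p1 gen 20. Closes NO item.

**THEOREM `symbolicDet_one_ne_zero_of_conjL` (the TOTAL MULTI-PEEL REDUCTION, memo §20, kernel-checked).** Assume Conjecture L (`Stmt.stub_conjL`, file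
`…BalancedMatching`, p617941). Let `(u, w)` be an injective layout whose rows are ALL subsets of `π(Γ)` and whose columns form a lower family of faces of
`Γ ∪ {c₀}` (`c₀ ∉ Γ`, `π` a vertex permutation identifying the two sides). Then `symbolicDet 1 h r u w ≠ 0` (hence `symbolicDet s ≠ 0` for every
`s ≥ 1` by `symbolicDet_ne_zero_mono`, and an anchored hit by `stub_genericPoint`).
PROOF. `K := lk_{c₀} C`, `D := del_{c₀} C`, transported to `Fin n` (`n = |Γ|`), form a balanced pair (`K ⊆ D` lower, `|K| + |D| = |C| = r = 2^n`); Conjecture L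
gives complex `θ, φ` for which the door compression `[B ⊆ U]·g(U∖B)` (rows `U ∉ D`, columns `B ∈ K`) has independent columns. Evaluate the symbolic minor at
the multi-peel point (`…TotalMultiPeel`): the layout of the member `D_spec` has unit columns at the columns `W ∌ c₀` (entry `[U = πW]`) and door-compression
columns at `W ∋ c₀` (entry `[π(W∖c₀) ⊆ U]·g(U ∖ π(W∖c₀))`, `coeff_multiPeel`); a kernel vector of this matrix restricted to the rows `U ∉ πD` is a column
dependency of the compression — zero by L — and then the unit columns force the rest to vanish. So the evaluated determinant is nonzero.

WHAT THIS IS NOT: Conjecture L is OPEN (numerics only); this file proves the implication, not the residual; nothing on crux stmt-ValiantsHypothesis-14610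
or on `VP` versus `VNP`.
-/

set_option linter.dupNamespace false

namespace Summit.ValiantsHypothesis.ValiantsHypothesis.Theorems.BarrierLever.AnchoredPeeling

open Finset MvPolynomial
open Summit.ValiantsHypothesis.ValiantsHypothesis.Theorems.BarrierLever.BrickCalculus (pexpo pexpo_def pexpo_le_iff pexpo_sub brick)

noncomputable section

variable {h : ℕ}

/-- The door coefficient transported along an embedding `e : Fin n ↪ Fin h`: with `θX (e i) = θ i`, `φX (e i) (e i') = φ i i'`,
`doorCoeffX θX φX (T.map e) = ConjL.doorCoeff θ φ T`. -/
theorem doorCoeffX_map {n : ℕ} (e : Fin n ↪ Fin h) (θ : Fin n → ℂ) (φ : Fin n → Fin n → ℂ) (θX : Fin h → ℂ) (φX : Fin h → Fin h → ℂ)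
    (hθ : ∀ i, θX (e i) = θ i) (hφ : ∀ i i', φX (e i) (e i') = φ i i') (T : Finset (Fin n)) :
    doorCoeffX θX φX (T.map e) = ConjL.doorCoeff θ φ T := by
  classical
  rw [doorCoeffX, ConjL.doorCoeff, Finset.sum_map]
  refine Finset.sum_congr rfl (fun i _ => ?_)
  rw [hθ, ← Finset.map_erase, Finset.prod_map]
  exact congrArg _ (Finset.prod_congr rfl (fun i' _ => hφ i i'))

/-- **CONJECTURE L ⟹ the cube against every complex on `n + 1` vertices is hit at profile 1.** See the module docstring. -/
theorem symbolicDet_one_ne_zero_of_conjL (hL : Stmt.stub_conjL) {r : ℕ} (u w : Fin r → Finset (Fin h))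
    (hu : Function.Injective u) (hw : Function.Injective w) (hlw : IsLowerSet (Set.range w))
    (Γ : Finset (Fin h)) (c₀ : Fin h) (hc₀ : c₀ ∉ Γ) (π : Equiv.Perm (Fin h))
    (hrows : ∀ S, S ∈ Set.range u ↔ S ⊆ Γ.image π) (hcols : ∀ j, w j ⊆ insert c₀ Γ) :
    symbolicDet 1 h r u w ≠ 0 := by
  classical
  -- (1) transport `Γ ≃ Fin n`
  set n : ℕ := Γ.card with hn
  let eΓ : Γ ≃ Fin n := Fintype.equivFinOfCardEq (Fintype.card_coe Γ)
  let vtxΓ : Fin n → Fin h := fun i => (eΓ.symm i).1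
  have hvtxΓ_mem : ∀ i, vtxΓ i ∈ Γ := fun i => (eΓ.symm i).2
  have hvtxΓ_inj : Function.Injective vtxΓ := fun i i' hii => eΓ.symm.injective (Subtype.ext hii)
  let emb : Fin n ↪ Fin h := ⟨fun i => π (vtxΓ i), fun i i' hii => hvtxΓ_inj (π.injective hii)⟩
  let toF : Finset (Fin h) → Finset (Fin n) := fun S => Finset.univ.filter (fun i => vtxΓ i ∈ S)
  -- the x-face of a transported face is `π (S ∩ Γ)`
  have htoF_map : ∀ S, S ⊆ insert c₀ Γ → (toF S).map emb = (S.erase c₀).image π := by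
    intro S hS
    ext x
    simp only [Finset.mem_map, Finset.mem_filter, Finset.mem_univ, true_and, Finset.mem_image, Finset.mem_erase, toF, emb,
      Function.Embedding.coeFn_mk]
    constructor
    · rintro ⟨i, hi, rfl⟩
      exact ⟨vtxΓ i, ⟨fun h' => hc₀ (h' ▸ hvtxΓ_mem i), hi⟩, rfl⟩
    · rintro ⟨y, ⟨hyc, hyS⟩, rfl⟩
      have hyΓ : y ∈ Γ := by
        rcases Finset.mem_insert.mp (hS hyS) with h' | h'
        · exact absurd h' hyc
        · exact h'
      refine ⟨eΓ ⟨y, hyΓ⟩, ?_, ?_⟩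
      · show vtxΓ (eΓ ⟨y, hyΓ⟩) ∈ S
        simp only [vtxΓ, Equiv.symm_apply_apply]; exact hyS
      · show π (vtxΓ (eΓ ⟨y, hyΓ⟩)) = π y
        simp only [vtxΓ, Equiv.symm_apply_apply]
  -- pulling a `Fin n`-face back to a face of `Γ`
  let fromF : Finset (Fin n) → Finset (Fin h) := fun T => T.image vtxΓ
  have hfromF_sub : ∀ T, fromF T ⊆ Γ := fun T x hx => by
    obtain ⟨i, -, rfl⟩ := Finset.mem_image.mp hx; exact hvtxΓ_mem i
  have htoF_fromF : ∀ T, toF (fromF T) = T := fun T => by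
    ext i
    simp only [toF, fromF, Finset.mem_filter, Finset.mem_univ, true_and, Finset.mem_image]
    exact ⟨fun ⟨i', hi', hii⟩ => hvtxΓ_inj hii ▸ hi', fun hi => ⟨i, hi, rfl⟩⟩
  have hfromF_toF : ∀ S, S ⊆ insert c₀ Γ → fromF (toF S) = S.erase c₀ := fun S hS => by
    apply Finset.image_injective π.injective
    show ((toF S).image vtxΓ).image π = (S.erase c₀).image π
    rw [Finset.image_image, ← htoF_map S hS, Finset.map_eq_image]
    rfl
  have htoF_mono : ∀ S S', S ⊆ S' → toF S ⊆ toF S' := fun S S' hSS' i hi => by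
    simp only [toF, Finset.mem_filter, Finset.mem_univ, true_and] at hi ⊢; exact hSS' hi
  -- injectivity of `j ↦ toF (w j)` on columns with the same c₀-status
  have htoF_inj : ∀ j j', (c₀ ∈ w j ↔ c₀ ∈ w j') → toF (w j) = toF (w j') → j = j' := by
    intro j j' hcc heq
    apply hw
    have h1 := hfromF_toF (w j) (hcols j)
    have h2 := hfromF_toF (w j') (hcols j')
    rw [heq] at h1
    have h3 : (w j).erase c₀ = (w j').erase c₀ := h1.symm.trans h2
    by_cases hc : c₀ ∈ w j
    · rw [← Finset.insert_erase hc, ← Finset.insert_erase (hcc.mp hc), h3]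
    · rw [← Finset.erase_eq_of_notMem hc, ← Finset.erase_eq_of_notMem (fun h' => hc (hcc.mpr h')), h3]
  -- (2) the balanced pair
  let J₁ : Finset (Fin r) := Finset.univ.filter (fun j => c₀ ∈ w j)
  let J₀ : Finset (Fin r) := Finset.univ.filter (fun j => c₀ ∉ w j)
  let K : Finset (Finset (Fin n)) := J₁.image (fun j => toF (w j))
  let D : Finset (Finset (Fin n)) := J₀.image (fun j => toF (w j))
  have hmemK : ∀ {B}, B ∈ K ↔ ∃ j, c₀ ∈ w j ∧ toF (w j) = B := fun {B} => by
    simp only [K, J₁, Finset.mem_image, Finset.mem_filter, Finset.mem_univ, true_and]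
  have hmemD : ∀ {B}, B ∈ D ↔ ∃ j, c₀ ∉ w j ∧ toF (w j) = B := fun {B} => by
    simp only [D, J₀, Finset.mem_image, Finset.mem_filter, Finset.mem_univ, true_and]
  -- a sub-face of a transported column, lifted: `fromF T ∪ (c₀?)` is again a column
  have hlowD : IsLowerSet (D : Set (Finset (Fin n))) := by
    intro T T' hT'T hT
    rw [Finset.mem_coe, hmemD] at hT ⊢
    obtain ⟨j, hcj, rfl⟩ := hT
    have hsub : fromF T' ⊆ w j := by
      refine (Finset.image_subset_image hT'T).trans ?_
      show fromF (toF (w j)) ⊆ w j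
      rw [hfromF_toF (w j) (hcols j)]; exact Finset.erase_subset _ _
    obtain ⟨j', hj'⟩ := hlw hsub ⟨j, rfl⟩
    refine ⟨j', fun hc => hc₀ (hfromF_sub T' (hj' ▸ hc)), ?_⟩
    rw [hj', htoF_fromF]
  have hlowK : IsLowerSet (K : Set (Finset (Fin n))) := by
    intro T T' hT'T hT
    rw [Finset.mem_coe, hmemK] at hT ⊢
    obtain ⟨j, hcj, rfl⟩ := hT
    have hsub : insert c₀ (fromF T') ⊆ w j := by
      refine Finset.insert_subset hcj ((Finset.image_subset_image hT'T).trans ?_)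
      show fromF (toF (w j)) ⊆ w j
      rw [hfromF_toF (w j) (hcols j)]; exact Finset.erase_subset _ _
    obtain ⟨j', hj'⟩ := hlw hsub ⟨j, rfl⟩
    refine ⟨j', by rw [hj']; exact Finset.mem_insert_self _ _, ?_⟩
    rw [hj']
    have : toF (insert c₀ (fromF T')) = toF (fromF T') := by
      ext i
      simp only [toF, Finset.mem_filter, Finset.mem_univ, true_and, Finset.mem_insert]
      exact ⟨fun h' => h'.resolve_left (fun h'' => hc₀ (h'' ▸ hvtxΓ_mem i)), fun h' => Or.inr h'⟩
    rw [this, htoF_fromF]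
  have hKD : K ⊆ D := by
    intro B hB
    rw [hmemK] at hB; rw [hmemD]
    obtain ⟨j, hcj, rfl⟩ := hB
    obtain ⟨j', hj'⟩ := hlw (Finset.erase_subset c₀ (w j)) ⟨j, rfl⟩
    refine ⟨j', by rw [hj']; exact Finset.notMem_erase c₀ _, ?_⟩
    rw [hj']
    ext i
    simp only [toF, Finset.mem_filter, Finset.mem_univ, true_and, Finset.mem_erase]
    exact ⟨fun h' => h'.2, fun h' => ⟨fun h'' => hc₀ (h'' ▸ hvtxΓ_mem i), h'⟩⟩
  have hcardK : K.card = J₁.card := Finset.card_image_of_injOn (fun j hj j' hj' heq => by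
    simp only [Finset.mem_coe, J₁, Finset.mem_filter, Finset.mem_univ, true_and] at hj hj'
    exact htoF_inj j j' ⟨fun _ => hj', fun _ => hj⟩ heq)
  have hcardD : D.card = J₀.card := Finset.card_image_of_injOn (fun j hj j' hj' heq => by
    simp only [Finset.mem_coe, J₀, Finset.mem_filter, Finset.mem_univ, true_and] at hj hj'
    exact htoF_inj j j' ⟨fun h' => absurd h' hj, fun h' => absurd h' hj'⟩ heq)
  have hr : r = 2 ^ n := by
    have himg : Finset.univ.image u = (Γ.image π).powerset := by
      ext S
      rw [Finset.mem_image, Finset.mem_powerset]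
      constructor
      · rintro ⟨i, -, rfl⟩; exact (hrows (u i)).mp ⟨i, rfl⟩
      · intro hS; obtain ⟨i, hi⟩ := (hrows S).mpr hS; exact ⟨i, Finset.mem_univ _, hi⟩
    have := congrArg Finset.card himg
    rwa [Finset.card_image_of_injective _ hu, Finset.card_univ, Fintype.card_fin, Finset.card_powerset,
      Finset.card_image_of_injective _ π.injective] at this
  have hcard : K.card + D.card = 2 ^ n := by
    rw [hcardK, hcardD, ← hr]
    have := Finset.card_filter_add_card_filter_not (s := (Finset.univ : Finset (Fin r))) (fun j => c₀ ∈ w j)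
    rw [Finset.card_univ, Fintype.card_fin] at this
    exact this
  -- (3) Conjecture L at the balanced pair
  obtain ⟨θ, φ, hker⟩ := hL n K D hlowK hlowD hKD hcard
  let θX : Fin h → ℂ := fun b => if hb : π.symm b ∈ Γ then θ (eΓ ⟨π.symm b, hb⟩) else 0
  let φX : Fin h → Fin h → ℂ := fun b b' =>
    if hb : π.symm b ∈ Γ then (if hb' : π.symm b' ∈ Γ then φ (eΓ ⟨π.symm b, hb⟩) (eΓ ⟨π.symm b', hb'⟩) else 0) else 0
  have hemb : ∀ i, emb i = π (vtxΓ i) := fun i => rfl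
  have hsymm : ∀ i, π.symm (π (vtxΓ i)) = vtxΓ i := fun i => π.symm_apply_apply _
  have heΓ : ∀ (x : Fin h) (hx : x ∈ Γ) (i : Fin n), x = vtxΓ i → eΓ ⟨x, hx⟩ = i := fun x hx i hxi =>
    eΓ.symm.injective (by rw [Equiv.symm_apply_apply]; exact Subtype.ext hxi)
  have hθX : ∀ i, θX (emb i) = θ i := fun i => by
    have hmem : π.symm (π (vtxΓ i)) ∈ Γ := by rw [hsymm]; exact hvtxΓ_mem i
    rw [hemb]
    show (if hb : π.symm (π (vtxΓ i)) ∈ Γ then θ (eΓ ⟨π.symm (π (vtxΓ i)), hb⟩) else 0) = θ i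
    rw [dif_pos hmem, heΓ _ hmem i (hsymm i)]
  have hφX : ∀ i i', φX (emb i) (emb i') = φ i i' := fun i i' => by
    have hmem : π.symm (π (vtxΓ i)) ∈ Γ := by rw [hsymm]; exact hvtxΓ_mem i
    have hmem' : π.symm (π (vtxΓ i')) ∈ Γ := by rw [hsymm]; exact hvtxΓ_mem i'
    rw [hemb, hemb]
    show (if hb : π.symm (π (vtxΓ i)) ∈ Γ then (if hb' : π.symm (π (vtxΓ i')) ∈ Γ then
      φ (eΓ ⟨π.symm (π (vtxΓ i)), hb⟩) (eΓ ⟨π.symm (π (vtxΓ i')), hb'⟩) else 0) else 0) = φ i i'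
    rw [dif_pos hmem, dif_pos hmem', heΓ _ hmem i (hsymm i), heΓ _ hmem' i' (hsymm i')]
  -- (4) evaluate the symbolic minor at the multi-peel point
  intro h0
  have hmap := congrArg (eval (multiPeelPoint Γ π c₀ θX φX)) h0
  rw [map_zero, symbolicDet, RingHom.map_det] at hmap
  set L₀ : Matrix (Fin r) (Fin r) ℂ := Matrix.of fun i j => coeff (pexpo (u i) (w j)) (cpart θX φX c₀ * ∏ γ ∈ Γ, brick {π γ} {γ}) with hL₀
  have hM : (eval (multiPeelPoint Γ π c₀ θX φX)).mapMatrix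
      (Matrix.of fun i j : Fin r => coeff (∑ a ∈ u i, Finsupp.single (Fin.castAdd h a) 1 + ∑ c ∈ w j, Finsupp.single (Fin.natAdd h c) 1)
        (symbolicWitness 1 h)) = L₀ := by
    refine Matrix.ext (fun i j => ?_)
    rw [RingHom.mapMatrix_apply, Matrix.map_apply, Matrix.of_apply, ← pexpo_def, ← coeff_map,
      map_multiPeelPoint_symbolicWitness Γ π c₀ θX φX hc₀, hL₀, Matrix.of_apply]
  rw [hM] at hmap
  obtain ⟨v, hv0, hv⟩ := Matrix.exists_mulVec_eq_zero_iff.mpr hmap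
  -- entries of L₀
  have hentry : ∀ i j, L₀ i j = if ((w j).erase c₀).image π ⊆ u i then
      (if c₀ ∈ w j then doorCoeffX θX φX (u i \ ((w j).erase c₀).image π) else (if u i = (w j).image π then 1 else 0)) else 0 :=
    fun i j => by rw [hL₀, Matrix.of_apply, coeff_multiPeel Γ π c₀ θX φX hc₀ (u i) (w j) (hcols j)]
  have hrow : ∀ i, ∑ j, L₀ i j * v j = 0 := fun i => by
    have := congrFun hv i
    rwa [Matrix.mulVec, dotProduct] at this
  -- (5) columns through c₀: the compression's columns are independent (Conjecture L)
  let cB : Finset (Fin n) → ℂ := fun B => ∑ j ∈ J₁.filter (fun j => toF (w j) = B), v j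
  have hcB : ∀ j, c₀ ∈ w j → cB (toF (w j)) = v j := by
    intro j hcj
    have hfilt : J₁.filter (fun j' => toF (w j') = toF (w j)) = {j} := by
      ext j'
      simp only [J₁, Finset.mem_filter, Finset.mem_univ, true_and, Finset.mem_singleton]
      constructor
      · rintro ⟨hcj', heq⟩; exact htoF_inj j' j ⟨fun _ => hcj, fun _ => hcj'⟩ heq
      · rintro rfl; exact ⟨hcj, rfl⟩
    show ∑ j' ∈ J₁.filter (fun j' => toF (w j') = toF (w j)), v j' = v j
    rw [hfilt, Finset.sum_singleton]
  have hv1 : ∀ j, c₀ ∈ w j → v j = 0 := by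
    have hzero := hker cB (fun U' hU' => ?_)
    · intro j hcj
      rw [← hcB j hcj]
      exact hzero _ (hmemK.mpr ⟨j, hcj, rfl⟩)
    -- the row `U = U'.map emb`
    obtain ⟨i₀, hi₀⟩ := (hrows (U'.map emb)).mpr (fun x hx => by
      obtain ⟨i, -, rfl⟩ := Finset.mem_map.mp hx
      exact Finset.mem_image_of_mem _ (hvtxΓ_mem i))
    have key := hrow i₀
    -- compute the row
    have hterm : ∀ j, L₀ i₀ j * v j = if c₀ ∈ w j then
        (if toF (w j) ⊆ U' then v j * ConjL.doorCoeff θ φ (U' \ toF (w j)) else 0) else 0 := by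
      intro j
      rw [hentry, hi₀, ← htoF_map (w j) (hcols j)]
      by_cases hcj : c₀ ∈ w j
      · rw [if_pos hcj]
        by_cases hsub : toF (w j) ⊆ U'
        · have hsub' : (toF (w j)).map emb ⊆ U'.map emb := Finset.map_subset_map.mpr hsub
          rw [if_pos hsub', if_pos hcj, if_pos hsub, ← Finset.map_sdiff, doorCoeffX_map emb θ φ θX φX hθX hφX, mul_comm]
        · have hsub' : ¬ (toF (w j)).map emb ⊆ U'.map emb := fun h' => hsub (Finset.map_subset_map.mp h')
          rw [if_neg hsub', if_pos hcj, if_neg hsub, zero_mul]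
      · rw [if_neg hcj, if_neg hcj]
        have hne : U'.map emb ≠ (w j).image π := by
          intro heq
          apply hU'
          rw [hmemD]
          refine ⟨j, hcj, ?_⟩
          have h1 : (toF (w j)).map emb = ((w j).erase c₀).image π := htoF_map (w j) (hcols j)
          rw [Finset.erase_eq_of_notMem hcj, ← heq] at h1
          exact Finset.map_injective emb h1
        rw [if_neg hne]
        by_cases h1 : (toF (w j)).map emb ⊆ U'.map emb
        · rw [if_pos h1, zero_mul]
        · rw [if_neg h1, zero_mul]
    simp_rw [hterm] at key
    rw [← Finset.sum_filter] at key
    -- reindex the sum by `B = toF (w j)`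
    have hfilter : K.filter (· ⊆ U') = (J₁.filter (fun j => toF (w j) ⊆ U')).image (fun j => toF (w j)) := by
      ext B
      simp only [Finset.mem_filter, hmemK, Finset.mem_image, J₁, Finset.mem_univ, true_and]
      constructor
      · rintro ⟨⟨j, hcj, rfl⟩, hB⟩; exact ⟨j, ⟨hcj, hB⟩, rfl⟩
      · rintro ⟨j, ⟨hcj, hB⟩, rfl⟩; exact ⟨⟨j, hcj, rfl⟩, hB⟩
    have hinj : ∀ j ∈ J₁.filter (fun j => toF (w j) ⊆ U'), ∀ j' ∈ J₁.filter (fun j => toF (w j) ⊆ U'),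
        toF (w j) = toF (w j') → j = j' := by
      intro j hj j' hj' heq
      simp only [Finset.mem_filter, J₁, Finset.mem_univ, true_and] at hj hj'
      exact htoF_inj j j' ⟨fun _ => hj'.1, fun _ => hj.1⟩ heq
    rw [← key, hfilter, Finset.sum_image hinj, Finset.sum_filter]
    refine Finset.sum_congr rfl (fun j hj => ?_)
    simp only [Finset.mem_filter, Finset.mem_univ, true_and] at hj
    by_cases hsub : toF (w j) ⊆ U'
    · rw [if_pos hsub, if_pos hsub, hcB j hj]
    · rw [if_neg hsub, if_neg hsub]
  -- (6) columns avoiding c₀: unit columns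
  have hv2 : ∀ j, c₀ ∉ w j → v j = 0 := by
    intro j₀ hcj₀
    obtain ⟨i₀, hi₀⟩ := (hrows ((w j₀).image π)).mpr (Finset.image_subset_image (fun x hx => by
      rcases Finset.mem_insert.mp (hcols j₀ hx) with h' | h'
      · exact absurd (h' ▸ hx) hcj₀
      · exact h'))
    have key := hrow i₀
    rw [Finset.sum_eq_single j₀] at key
    · rw [hentry, hi₀, Finset.erase_eq_of_notMem hcj₀, if_pos subset_rfl, if_neg hcj₀, if_pos rfl, one_mul] at key
      exact key
    · intro j _ hne
      by_cases hcj : c₀ ∈ w j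
      · rw [hv1 j hcj, mul_zero]
      · rw [hentry, hi₀, if_neg hcj]
        have hne' : (w j₀).image π ≠ (w j).image π := fun heq => hne (hw (Finset.image_injective π.injective heq)).symm
        by_cases h1 : ((w j).erase c₀).image π ⊆ (w j₀).image π
        · rw [if_pos h1, if_neg hne', zero_mul]
        · rw [if_neg h1, zero_mul]
    · intro h'; exact absurd (Finset.mem_univ _) h'
  exact hv0 (funext fun j => by
    by_cases hcj : c₀ ∈ w j
    · exact hv1 j hcj
    · exact hv2 j hcj)

end

end Summit.ValiantsHypothesis.ValiantsHypothesis.Theorems.BarrierLever.AnchoredPeeling
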